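import Summits.QuantumFields.YangMills.Theses.BalabanUVNodes
import Summits.QuantumFields.YangMills.Theorems.BalabanUVNodesK1WindowKOfRunRowsSurvivors

/-!
# Route `BalabanUVNodes` rev 31∕33 (director-ym №467 (D) V1′ ADD-AND-REGLUE; dag-lead g40 HANDS OP 4): THE K2ᴬ CLOSER — `EndpointGivenRunRowsR13SepCoPHVAx` (support, born closed) HOLDS OUTRIGHT

Seat `pub-ymgap-dag-n24-c` (g22), `--kind proof --workitem stmt-QuantumFields-27246` (precedents: b2b-an4's `…BalabanUVNodesK2R8Holds` for K2⁸,
DEF-1 gen 9's `…BalabanUVNodesK2R9Holds` for K2⁹ stmt-QuantumFields-27365).  The item K2ᴬ = K2⁹'s text under the name substitution σ of №467 (D):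
`Provisos₁₃SepCoPH ↦ Provisos₁₃SepCoPHAx`, `betaOfRecord₁₃ ↦ betaOfRecord₁₃Ax`, `datumOfRecord₁₃SepCoPHV ↦ datumOfRecord₁₃SepCoPHVAx`, `Revision₁₃ ↦ Revision₁₃Ax`,
`SlotsNondegenerate₁₃ ↦ SlotsNondegenerate₁₃Ax` — the endpoint step read at the RE-CENTRED record (the (2.9) small-field cut-off centred at the block-axial representative,
`Node00/Record13SepCoPHChi`).  At a Stage-13 tuple with the re-centred provisos and ANY revision `v : Node00.Revision₁₃Ax F 2 θ h`: unity ∧ slots, admissibility, (B) of the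
re-centred revised datum, the RUN ROWS (i) run-wise constant remainder ∕ (iv) partial-sum floor ∕ (C) survivor continuity of `Node00.betaOfRecord₁₃Ax F 2 θ.toStage13Params` at
SOME level `γ₀ > 0` (bodies inlined in the item text) and the window clause ⟹ `DagBinding.EndpointExistence (Node00.datumOfRecord₁₃SepCoPHVAx F 2 θ h v).C.toB12`.

PROOF (the two centre-blind lines of `K2R9Holds` :33–:35 over the Ax faces, as the item's docstring prescribes).  (1) END IS VERSION-FREE at the re-centred record:
`Node00.endpointExistence_datumOfRecord₁₃SepCoPHVAx_iff` (`Iff.rfl`, `Node00/Record13SepCoPHChi` :639).  (2) THE END TWIN is CENTRE-BLIND: n24's generic END theorem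
`BalabanUVNodesK1WindowKOfRunRowsSurvivors.endpointExistence_of_runConstRemainder_runwisePS_survCont` reads ONLY a forward-generated construction `C` and the three row letters of
its generating `β` — here `C := (Node00.datumOfRecord₁₃SepCoPHAx F N θ h).C.toB12`, forward-generated by `β := Node00.betaOfRecord₁₃Ax F N θ.toStage13Params` (the datum's own
`FiniteEpsData.fwd`; `(datum).βfun = betaOfRecord₁₃Ax …` is `Node00.βfun_datumOfRecord₁₃SepCoPHAx`, `rfl`).  §1 states that twin (`endpointExistence_datumOfRecord₁₃SepCoPHAx_of_runRows_survCont`,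
general `N`); §2 is the closer.  Unity, admissibility, (B), the version `v` and the window are NOT read (as for K2⁹).

HONEST FRAMING.  This closes a BORN-CLOSED SUPPORT item — the DISPLAY of the rung's END step under the re-centred (Ax) shape; it moves NO load-bearing crux (the open cruxes of the cone
are K0ᴬ stmt-QuantumFields-27238, K1ᴬ stmt-QuantumFields-27239 (DECIDING; it owes (B) at some revision, the window and the rows at its witness) and K3ᴬ stmt-QuantumFields-27247), discharges
NO node of the 28, proves NO registered stub, asserts NOTHING of Bałaban's analysis; counts unmoved by this file; [Balaban1987RG1] Thm 2 + (0.31) p. 259 and §1's continuity (pp. 263–264)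
are UNPROVED IN PRINT; route R4 closes the CONDITIONAL finite-𝕋⁴ rung `BalabanLadder.UV` only — ONE kernel implication on ONE finite 𝕋⁴ at fixed ε; NOT the continuum limit, NOT ℝ⁴,
NOT OS, NOT the Yang–Mills mass gap, NOT Clay.  No `def`, no `instance`, no `notation`, no `axiom`.  Sources (context only): [I] = [Balaban1987RG1] CMP **109** (1987): Thm 2 p. 259 (first
sentence), Thm 3 p. 264, (5.10) p. 293, §1 pp. 263–264; [III] = [Balaban1988Convergent] CMP **119** (1988): (2.18) p. 257, Cor. 3 (2.50) p. 264; [14] = [Balaban1988RG2Cluster] CMP **116**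
(1988): (2.5)∕(2.9) (the re-centred cut-off), (2.41) p. 21.
-/

noncomputable section

namespace Summit.QuantumFields.YangMills.Theorems.BalabanUVNodesK2AxHolds

open Literature.MathematicalPhysics.QuantumFieldTheory.Balaban1983to89
open Literature.MathematicalPhysics.QuantumFieldTheory.Balaban1983to89.FlowStep
open Literature.MathematicalPhysics.QuantumFieldTheory.Balaban1983to89.DagBinding
open Literature.MathematicalPhysics.QuantumFieldTheory.Balaban1983to89.T4Continuum (T4Family)
open Literature.MathematicalPhysics.QuantumFieldTheory.Balaban1983to89.Node00
open Summit.QuantumFields.YangMills.Theorems.BalabanUVNodesK2NamedJetsRunRemAt (RunConstRemainder SurvCont)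
open Summit.QuantumFields.YangMills.Theorems.BalabanUVNodesK1WindowKOfRunRowsSurvivors (endpointExistence_of_runConstRemainder_runwisePS_survCont)

/-! ## §1  The END twin at the RE-CENTRED Stage-13 datum (general `N`; centre-blind) -/

variable {F : T4Family} {N : ℕ} [NeZero N] in
/-- ★★ **AT THE RE-CENTRED STAGE-13 DATUM (general `N`): ROWS (i)+(iv) FOR `betaOfRecord₁₃Ax θ` + (C) AT THE SAME LEVEL ⟹ `EndpointExistence (datumOfRecord₁₃SepCoPHAx F N θ h).C.toB12`**
— the Ax twin of `…K1WindowKOfRunRowsSurvivors.endpointExistence_datumOfRecord₁₃SepCoPH_of_runRows_survCont`: the re-centred datum is forward-generated by its own β of record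
(`(datum).fwd`, `(datum).βfun = betaOfRecord₁₃Ax θ` by `rfl`), and the generic END road reads nothing else (centre-blind).  NO drift, NO anchor, NO cap, NO (B), NO ceiling match are read.
CONDITIONAL on the three displayed row letters; K1ᴬ ∕ K2ᴬ not touched by this lemma alone. [cite: Balaban1987RG1, Thm 2 p.259 (first sentence), Thm 3 p.264, (5.10) p.293, §1 pp.263–264; Balaban1988RG2Cluster, (2.9) p.12, (2.41) p.21; Balaban1989LargeFieldII, Thm 1 p.355 (bookkeeping)] -/
theorem endpointExistence_datumOfRecord₁₃SepCoPHAx_of_runRows_survCont (θ : Stage13HParams F N) (h : θ.Provisos₁₃SepCoPHAx F N) {b : ℕ → ℝ} {r γ₀ M : ℝ} (hγ₀ : 0 < γ₀)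
    (hrem : RunConstRemainder (betaOfRecord₁₃Ax F N θ.toStage13Params) b r γ₀)
    (hps : ∀ (n : ℕ) (gs : ℕ → ℝ), RGEqH n (betaOfRecord₁₃Ax F N θ.toStage13Params) gs → Step.InInterval γ₀ n gs →
      ∀ k, k ≤ n → -M ≤ ∑ j ∈ Finset.Ico k n, betaOfRecord₁₃Ax F N θ.toStage13Params j (prefixOf gs j))
    (hsc : SurvCont (betaOfRecord₁₃Ax F N θ.toStage13Params) γ₀) :
    EndpointExistence (datumOfRecord₁₃SepCoPHAx F N θ h).C.toB12 :=
  endpointExistence_of_runConstRemainder_runwisePS_survCont (datumOfRecord₁₃SepCoPHAx F N θ h).fwd hγ₀ hrem hps hsc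

/-! ## §2  The K2ᴬ closer -/

/-- **K2ᴬ `EndpointGivenRunRowsR13SepCoPHVAx` HOLDS** (route `BalabanUVNodes` rev 31∕33, support, born closed; dag-lead g40 HANDS op 4): at every revision `v` of the RE-CENTRED record the
displayed run rows (i)+(iv)+(C) of `betaOfRecord₁₃Ax θ` at one window `γ₀ > 0` give the endpoint-existence half of [I] Thm 2 for the re-centred revised Stage-13 datum — END is
version-free (`Node00.endpointExistence_datumOfRecord₁₃SepCoPHVAx_iff`, `Iff.rfl`) and at the re-centred record it is §1's centre-blind END twin BY NAME; unity, admissibility, (B), `v`,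
the window clause unused.  CLOSES a born-closed SUPPORT item only; K1ᴬ owes the rows and the slot letter; nothing of Bałaban's asserted. [cite: Balaban1987RG1, Thm 2 p.259 (first sentence), Thm 3 p.264 and (5.10) p.293; Balaban1988RG2Cluster, (2.9) p.12 (bookkeeping)] -/
theorem endpointGivenRunRowsR13SepCoPHVAx_holds : Summit.QuantumFields.YangMills.Theses.BalabanUVNodes.EndpointGivenRunRowsR13SepCoPHVAx := by
  intro F θ h v _ _ _ hrows _
  obtain ⟨b, r, γ₀, M, hγ₀, hrem, hps, hsc⟩ := hrows
  exact (Node00.endpointExistence_datumOfRecord₁₃SepCoPHVAx_iff F 2 θ h v).mpr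
    (endpointExistence_datumOfRecord₁₃SepCoPHAx_of_runRows_survCont θ h hγ₀ hrem hps hsc)

end Summit.QuantumFields.YangMills.Theorems.BalabanUVNodesK2AxHolds

end
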